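import Summits.ABC.ABC.Theorems.TwistAmplificationSharpModerateLawDefs

/-!
# Crux `TwistAmplification.SharpModerateLaw` (stmt-ABC-1975): objects of the line
`deep-moduli-cusp-dispersion`

Definitions (and the kernel-checked glue between them) used by the positive-side files of the
picked line `Cruxes/SharpModerateLaw/Lines/deep_moduli_cusp_dispersion.lean` (lead
`prover-line-stmt-ABC-1975-c1-0`; skeleton by planner-cruxplan-stmt-ABC-1975-deep-moduli-cusp-dis-g2-0,
whose definitions these are VERBATIM, so that every registered stub signature of stmt-ABC-1975 —
which spells the objects out over Mathlib — unfolds to the named form definitionally):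

* §1 the transfer target C⁺′ over `ℤ²`: the all-prime conductor proxy `Nstar` (`p²` at additive
  primes, `p` at multiplicative ones, INCLUDING `p = 2, 3` — the sibling line's `N5cusp` drops them),
  the dyadic cusp set `cuspSetD X Y` (pairs `(c₄, c₆)` with `c₄c₆ ≠ 0`, cusp excised, `1728 ∣ c₄³ − c₆²`,
  tower-free `TF` (reused from `…SharpModerateLawDefs`), `M⁺ ∈ (Y/2, Y]`, `N* ≤ X`), the law
  `CuspLawD` on the cone `X³ ≤ 8Y ≤ 8X^σ`, and the restricted laws `LawOn P`;
* §2 the two resolution thresholds: the simple radical `simpleRad` (`r'`), the regimes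
  `HallRegime` (`|u³ − v²| ≤ 1728√Y`), `ResolvedRegime` (thick tube, `r' ≥ Y^{1/6}`),
  `DeepRegime` (thick tube, `r' < Y^{1/6}`), which cover (`regimes_cover`);
* §3 the complete cusp sums `cuspSum p n h₁ h₂ = Σ_{t < pⁿ, (t,p)=1} e((h₁t² + h₂t³)/pⁿ)` and the
  stationary-phase statement `CuspSumBound` (`|S| ≤ 2p^{n/2}`, registered stub `stub_cuspStationaryPhase`);
* §4 the named stub statements `TransferD`, `ResolvedRegimeLaw`, `DeepRegimeLaw`, `HallRegimeLaw`
  and the glue: `cuspSetD_finite`, `lawOn_mono`, `lawOn_or`, `cuspLawD_of_regimes`,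
  `sharpModerateLaw_of_transfer_of_regimeLaws` (crux ⟸ transfer ∧ three regime laws), plus the
  entry lemmas `cuspParam` (`(u,v) ≡ (t²,t³) mod e`) and `simpleRad_le_Nstar` (`r' ≤ N*`).

No stub is proved here; the stubs land in their own files and the composition in the skeleton.
-/

noncomputable section

namespace Summit.ABC.ABC.Theorems.SharpModerateLaw.CuspDispersion

open scoped BigOperators

/-! ## 1. The objects of C⁺′ -/

/-- Conductor proxy `N*(c₄,c₆) = ∏_{p ∣ Δ} (p² if p ∣ c₄ else p)`, `Δ = (c₄³ − c₆²)/1728`; on a minimal model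
`N* ≤ conductorNorm` (`p ∣ Δ`, `p ∤ c₄`: multiplicative, `f_p = 1`; `p ∣ Δ`, `p ∣ c₄`: additive, `f_p ≥ 2`). -/
def Nstar (x : ℤ × ℤ) : ℕ :=
  ∏ p ∈ ((x.1 ^ 3 - x.2 ^ 2) / 1728).natAbs.primeFactors, (if ((p : ℕ) : ℤ) ∣ x.1 then p ^ 2 else p)

/-- The DYADIC cusp set at scales `(X, Y)`: pairs `(u,v) = (c₄,c₆)` with `uv ≠ 0`, `u³ ≠ v²`, `1728 ∣ u³ − v²`,
tower-free, `M⁺ := max(|u|³, |u³−v²|/1728) ∈ (Y/2, Y]` and `N* ≤ X`. -/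
def cuspSetD (X Y : ℝ) : Set (ℤ × ℤ) :=
  {x | x.1 ≠ 0 ∧ x.2 ≠ 0 ∧ x.1 ^ 3 ≠ x.2 ^ 2 ∧ (1728 : ℤ) ∣ x.1 ^ 3 - x.2 ^ 2 ∧ TF x ∧
    ((|x.1| ^ 3 : ℤ) : ℝ) ≤ Y ∧ ((|x.1 ^ 3 - x.2 ^ 2| : ℤ) : ℝ) ≤ 1728 * Y ∧
    Y < 2 * max (((|x.1| ^ 3 : ℤ) : ℝ)) (((|x.1 ^ 3 - x.2 ^ 2| : ℤ) : ℝ) / 1728) ∧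
    (Nstar x : ℝ) ≤ X}

/-- **C⁺′ = `CuspLawD`**, the transfer target: `#cuspSetD(X,Y) ≤ C_{σ,ε} X^ε (X·Y^{-1/6} + 1)` for
`X, Y ≥ 1`, `X³/8 ≤ Y ≤ X^σ`, every `σ > 6`. -/
def CuspLawD : Prop :=
  ∀ σ : ℝ, 6 < σ → ∀ ε : ℝ, 0 < ε → ∃ C : ℝ, ∀ X Y : ℝ, 1 ≤ X → 1 ≤ Y → X ^ 3 ≤ 8 * Y → Y ≤ X ^ σ →
    (Set.ncard (cuspSetD X Y) : ℝ) ≤ C * X ^ ε * (X * Y ^ (-(1 / 6 : ℝ)) + 1)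

/-- The SIMPLE RADICAL `r'(u,v) = ∏_{p ∥ u³ − v²} p` (primes dividing `u³ − v²` exactly once; automatically `p ≥ 5`,
`p ∤ u`, multiplicative of type `I₁`). `|u³ − v²|/r'` carries all the depth (the dispersion modulus `e`, powerful and
prime to `u`) and all the additive primes. In the crux range `r' ≤ N* ≤ X ≤ 2Y^{1/3}` (`simpleRad_le_Nstar`). -/
def simpleRad (x : ℤ × ℤ) : ℕ :=
  ∏ p ∈ (x.1 ^ 3 - x.2 ^ 2).natAbs.primeFactors.filter (fun p : ℕ => ¬ (((p : ℕ) : ℤ) ^ 2 ∣ x.1 ^ 3 - x.2 ^ 2)), p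

/-! ## 2. The two resolution thresholds and the three regimes (cover: `regimes_cover`) -/

/-- HALL regime (archimedean corner): `|u³ − v²| ≤ 1728·Y^{1/2}`, i.e. `|Δ| ≤ Y^{1/2}`; with the dyadic floor this
forces `|u|³ > Y/2` and `||v| − u^{3/2}| < 2445`: integer points within `O(1)` of the real cusp, below archimedean
resolution (per `u` the `v`-count is `0/1`). -/
def HallRegime (Y : ℝ) (x : ℤ × ℤ) : Prop :=
  ((|x.1 ^ 3 - x.2 ^ 2| : ℤ) : ℝ) ≤ 1728 * Y ^ (1 / 2 : ℝ)

/-- RESOLVED regime: thick tube and `r' ≥ Y^{1/6}` — every modulus class expects `≳ 1` point (`R ≥ X^{s/6}` of the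
card's item 2); per-modulus estimates of optimal strength would suffice. (`r' ≤ 2Y^{1/3}` automatically.) -/
def ResolvedRegime (Y : ℝ) (x : ℤ × ℤ) : Prop :=
  ¬ (((|x.1 ^ 3 - x.2 ^ 2| : ℤ) : ℝ) ≤ 1728 * Y ^ (1 / 2 : ℝ)) ∧ Y ^ (1 / 6 : ℝ) ≤ (simpleRad x : ℝ)

/-- DEEP regime: thick tube and `r' < Y^{1/6}` — below resolution: `≍ X/r'` modulus classes each expecting `< 1`
point; only the average over the densely divisible modulus family can pay. -/
def DeepRegime (Y : ℝ) (x : ℤ × ℤ) : Prop :=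
  ¬ (((|x.1 ^ 3 - x.2 ^ 2| : ℤ) : ℝ) ≤ 1728 * Y ^ (1 / 2 : ℝ)) ∧ (simpleRad x : ℝ) < Y ^ (1 / 6 : ℝ)

/-- The law C⁺′ restricted to the pairs satisfying `P` (same constants shape, same right side). -/
def LawOn (P : ℝ → ℤ × ℤ → Prop) : Prop :=
  ∀ σ : ℝ, 6 < σ → ∀ ε : ℝ, 0 < ε → ∃ C : ℝ, ∀ X Y : ℝ, 1 ≤ X → 1 ≤ Y → X ^ 3 ≤ 8 * Y → Y ≤ X ^ σ →
    (Set.ncard {x : ℤ × ℤ | x ∈ cuspSetD X Y ∧ P Y x} : ℝ) ≤ C * X ^ ε * (X * Y ^ (-(1 / 6 : ℝ)) + 1)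


/-! ## 3. The complete cusp sums -/

/-- `S(h₁,h₂;pⁿ) = Σ_{t ∈ (ℤ/pⁿ)ˣ} e((h₁t² + h₂t³)/pⁿ)`, the complete exponential sum along the parametrised cusp
`(t², t³)` that every Poisson/completion step modulo the deep modulus produces (by CRT the sum to a powerful modulus
`e = ∏ pᵢ^{nᵢ}`, all `nᵢ ≥ 2`, factors into these). -/
noncomputable def cuspSum (p n : ℕ) (h₁ h₂ : ℤ) : ℂ :=
  ∑ t ∈ (Finset.range (p ^ n)).filter (fun t : ℕ => Nat.Coprime t p),
    Complex.exp (2 * (Real.pi : ℂ) * Complex.I * ((h₁ : ℂ) * (t : ℂ) ^ 2 + (h₂ : ℂ) * (t : ℂ) ^ 3) / (p : ℂ) ^ n)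

/-- **Stationary phase for the cusp sums** (IK Lemmas 12.2–12.3): for `p ≥ 5` prime, `n ≥ 2` and `(h₁,h₂)` not both
divisible by `p`, `|S(h₁,h₂;pⁿ)| ≤ 2·p^{n/2}`. Truth: the critical points of `f = h₁t² + h₂t³` on units solve
`t(2h₁ + 3h₂t) ≡ 0`, i.e. `t₀ ≡ −2h₁(3h₂)⁻¹`; if `p ∣ h₁` or `p ∣ h₂` (not both) no unit is critical and `S = 0`;
otherwise `t₀` is a nondegenerate unit critical point (`f''(t₀) = −2h₁`) and `|S| = p^{n/2}` exactly, with phase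
`e(f(t₀)/pⁿ) = e(4h₁³·(27h₂²)⁻¹/pⁿ)` times a Gauss-sum sign for odd `n`. The factor 2 is slack. -/
def CuspSumBound : Prop :=
  ∀ p n : ℕ, p.Prime → 5 ≤ p → 2 ≤ n → ∀ h₁ h₂ : ℤ, ¬ ((p : ℤ) ∣ h₁ ∧ (p : ℤ) ∣ h₂) →
    ‖cuspSum p n h₁ h₂‖ ≤ 2 * (p : ℝ) ^ ((n : ℝ) / 2)

/-! ## 4. The named stub statements -/

/-- Statement of the TRANSFER stub `stub_cuspTransfer` of the line: C⁺′ implies the crux. -/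
def TransferD : Prop :=
  CuspLawD → Summit.ABC.ABC.Theses.TwistAmplification.SharpModerateLaw

/-- Statement of `stub_resolvedRegime`: stationary phase ⇒ the law on the resolved regime. -/
def ResolvedRegimeLaw : Prop := CuspSumBound → LawOn ResolvedRegime

/-- Statement of `stub_deepRegime` (the hardest stub): stationary phase ⇒ the law on the deep regime. -/
def DeepRegimeLaw : Prop := CuspSumBound → LawOn DeepRegime

/-- Statement of `stub_hallRegime`: the law on the Hall regime. -/
def HallRegimeLaw : Prop := LawOn HallRegime

/-! ## 5. Entry lemmas of the lever -/

/-- The cusp parametrisation: for `e ∣ u³ − v²` with `gcd(u, e) = 1` the pair `(u,v)` lies on the parametrised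
cuspidal cubic mod `e`, `u ≡ t², v ≡ t³` with `t = v·u⁻¹` (Tate: `E₄ ≡ 1, E₆ ≡ 1 mod q`); from the planner's
skeleton (gen 1 / `Ideator2Sketch`). -/
theorem cuspParam (u v e : ℤ) (hcop : IsCoprime u e) (hdvd : e ∣ u ^ 3 - v ^ 2) :
    ∃ t : ℤ, t ^ 2 ≡ u [ZMOD e] ∧ t ^ 3 ≡ v [ZMOD e] := by
  obtain ⟨a, b, hab⟩ := hcop
  have h' : e ∣ v ^ 2 - u ^ 3 := by
    rw [show v ^ 2 - u ^ 3 = -(u ^ 3 - v ^ 2) by ring]; exact dvd_neg.mpr hdvd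
  refine ⟨v * a, ?_, ?_⟩
  · have h1 : (v * a) ^ 2 - u = (v ^ 2 - u ^ 3) * a ^ 2 - u * b * e * (u * a + 1) := by
      linear_combination (u * (u * a + 1)) * hab
    refine (Int.modEq_iff_dvd.mpr ?_).symm
    rw [h1]
    exact dvd_sub (h'.mul_right _) ⟨u * b * (u * a + 1), by ring⟩
  · have h2 : (v * a) ^ 3 - v
        = (v ^ 2 - u ^ 3) * v * a ^ 3 - v * b * e * ((u * a) ^ 2 + u * a + 1) := by
      linear_combination (v * ((u * a) ^ 2 + u * a + 1)) * hab
    refine (Int.modEq_iff_dvd.mpr ?_).symm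
    rw [h2]
    exact dvd_sub ((h'.mul_right _).mul_right _) ⟨v * b * ((u * a) ^ 2 + u * a + 1), by ring⟩

/-- A prime dividing `u³ − v²` exactly once, when `1728 ∣ u³ − v²`, is `≥ 5` … more precisely it is not `2` or `3`
(both divide `1728 = 2⁶3³` to at least the second power). -/
lemma simple_prime_ne_two_three {D : ℤ} (h1728 : (1728 : ℤ) ∣ D) {p : ℕ} (hp : p.Prime) (hpD : (p : ℤ) ∣ D)
    (hsimple : ¬ ((p : ℤ) ^ 2 ∣ D)) : p ≠ 2 ∧ p ≠ 3 := by
  constructor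
  · rintro rfl
    exact hsimple (dvd_trans ⟨432, by norm_num⟩ h1728)
  · rintro rfl
    exact hsimple (dvd_trans ⟨192, by norm_num⟩ h1728)

/-- **`r' ≤ N*`**: the simple radical divides into the conductor proxy — every prime `p ∥ u³ − v²` (with
`1728 ∣ u³ − v² ≠ 0`) is `≠ 2, 3`, divides `Δ = (u³−v²)/1728`, and is charged `p` or `p²` in `N*`. Consequence (with
`N* ≤ X ≤ 2Y^{1/3}` on the range `X³ ≤ 8Y`): `r' ≤ 2Y^{1/3}`, so the gen-1 "trivial regime" `r' ≥ Y^{1/2}` is empty for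
`Y > 64`. -/
theorem simpleRad_le_Nstar (x : ℤ × ℤ) (hD : x.1 ^ 3 - x.2 ^ 2 ≠ 0) (h1728 : (1728 : ℤ) ∣ x.1 ^ 3 - x.2 ^ 2) :
    simpleRad x ≤ Nstar x := by
  unfold simpleRad Nstar
  set D : ℤ := x.1 ^ 3 - x.2 ^ 2 with hDdef
  obtain ⟨Δ, hΔ⟩ := h1728
  have hΔ' : D / 1728 = Δ := by rw [hΔ]; simp
  have hΔne : Δ ≠ 0 := by
    rintro rfl; exact hD (by rw [hΔ]; simp)
  -- the simple primes form a subset of the prime factors of Δ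
  have hsub : (D.natAbs.primeFactors.filter (fun p : ℕ => ¬ (((p : ℕ) : ℤ) ^ 2 ∣ D))) ⊆ Δ.natAbs.primeFactors := by
    intro p hp
    rw [Finset.mem_filter] at hp
    obtain ⟨hpD, hsimple⟩ := hp
    have hpP : p.Prime := Nat.prime_of_mem_primeFactors hpD
    have hpdvdD : (p : ℤ) ∣ D := by
      have := Nat.dvd_of_mem_primeFactors hpD
      exact Int.ofNat_dvd_left.mpr this
    obtain ⟨hp2, hp3⟩ := simple_prime_ne_two_three ⟨Δ, hΔ⟩ hpP hpdvdD hsimple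
    -- p ∣ 1728 * Δ and p coprime to 1728 ⇒ p ∣ Δ
    have hcop : IsCoprime (p : ℤ) 1728 := by
      have h2 : ¬ (p ∣ 2) := fun h => hp2 ((Nat.prime_dvd_prime_iff_eq hpP Nat.prime_two).mp h)
      have h3 : ¬ (p ∣ 3) := fun h => hp3 ((Nat.prime_dvd_prime_iff_eq hpP Nat.prime_three).mp h)
      have hc2 : Nat.Coprime p 2 := (Nat.coprime_primes hpP Nat.prime_two).mpr (by
        rintro rfl; exact hp2 rfl)
      have hc3 : Nat.Coprime p 3 := (Nat.coprime_primes hpP Nat.prime_three).mpr (by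
        rintro rfl; exact hp3 rfl)
      have : Nat.Coprime p 1728 := by
        have h1728 : (1728 : ℕ) = 2 ^ 6 * 3 ^ 3 := by norm_num
        rw [h1728]
        exact Nat.Coprime.mul_right (Nat.Coprime.pow_right _ hc2) (Nat.Coprime.pow_right _ hc3)
      exact Int.isCoprime_iff_gcd_eq_one.mpr (by exact_mod_cast this)
    have hpΔ : (p : ℤ) ∣ Δ := by
      rw [hΔ] at hpdvdD
      exact hcop.dvd_of_dvd_mul_left hpdvdD
    have hpΔ' : p ∣ Δ.natAbs := Int.ofNat_dvd_left.mp hpΔ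
    exact Nat.mem_primeFactors.mpr ⟨hpP, hpΔ', Int.natAbs_ne_zero.mpr hΔne⟩
  rw [hΔ']
  calc ∏ p ∈ D.natAbs.primeFactors.filter (fun p : ℕ => ¬ (((p : ℕ) : ℤ) ^ 2 ∣ D)), p
      ≤ ∏ p ∈ Δ.natAbs.primeFactors, p := by
        apply Finset.prod_le_prod_of_subset_of_one_le' hsub
        intro p hp _
        exact (Nat.prime_of_mem_primeFactors hp).one_lt.le
    _ ≤ ∏ p ∈ Δ.natAbs.primeFactors, (if ((p : ℕ) : ℤ) ∣ x.1 then p ^ 2 else p) := by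
        apply Finset.prod_le_prod' (fun p hp => ?_)
        have h1 : 1 ≤ p := (Nat.prime_of_mem_primeFactors hp).one_lt.le
        split_ifs
        · calc p = p ^ 1 := (pow_one p).symm
            _ ≤ p ^ 2 := Nat.pow_le_pow_right h1 (by norm_num)
        · exact le_rfl

/-- On the range `X³ ≤ 8Y` of the law, `X ≤ 2·Y^{1/3}`. -/
lemma X_le_two_rpow_third {X Y : ℝ} (hX : 1 ≤ X) (hY : 1 ≤ Y) (hXY : X ^ 3 ≤ 8 * Y) :
    X ≤ 2 * Y ^ (1 / 3 : ℝ) := by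
  have hX0 : 0 ≤ X := by linarith
  have hY0 : 0 ≤ Y := by linarith
  have h13 : (1 / 3 : ℝ) = ((3 : ℕ) : ℝ)⁻¹ := by norm_num
  have h1 : (X ^ 3) ^ (1 / 3 : ℝ) = X := by
    rw [h13]; exact Real.pow_rpow_inv_natCast hX0 (by norm_num)
  have h2 : (X ^ 3) ^ (1 / 3 : ℝ) ≤ (8 * Y) ^ (1 / 3 : ℝ) :=
    Real.rpow_le_rpow (by positivity) hXY (by norm_num)
  have h3 : (8 * Y) ^ (1 / 3 : ℝ) = 2 * Y ^ (1 / 3 : ℝ) := by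
    rw [Real.mul_rpow (by norm_num) hY0]
    congr 1
    rw [show (8 : ℝ) = (2 : ℝ) ^ 3 by norm_num, h13]
    exact Real.pow_rpow_inv_natCast (by norm_num) (by norm_num)
  linarith [h1 ▸ h2, h3]

/-! ## 6. Glue (finiteness, union bound, cover, composition) -/

/-- `|x|³ ≤ T` with `T ≥ 1` gives `|x| ≤ T`. -/
private lemma abs_le_of_cube_le {x T : ℝ} (hT : 1 ≤ T) (h : |x| ^ 3 ≤ T) : |x| ≤ T := by
  rcases le_or_gt |x| 1 with h1 | h1
  · exact h1.trans hT
  · have h2 : 0 ≤ |x| * (|x| ^ 2 - 1) := mul_nonneg (abs_nonneg _) (by nlinarith)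
    nlinarith [h2]

/-- `y² ≤ T` with `T ≥ 1` gives `|y| ≤ T`. -/
private lemma abs_le_of_sq_le {y T : ℝ} (hT : 1 ≤ T) (h : y ^ 2 ≤ T) : |y| ≤ T := by
  rcases le_or_gt |y| 1 with h1 | h1
  · exact h1.trans hT
  · have h2 : 0 ≤ |y| * (|y| - 1) := mul_nonneg (abs_nonneg _) (by linarith)
    have h3 : |y| ^ 2 = y ^ 2 := sq_abs y
    nlinarith [h2, h3]

/-- The dyadic cusp set is finite (`|u| ≤ |u|³ ≤ Y`, `v² ≤ |u|³ + |u³ − v²| ≤ 1729Y`). -/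
theorem cuspSetD_finite (X Y : ℝ) (hY : 1 ≤ Y) : (cuspSetD X Y).Finite := by
  have hY' : (1 : ℝ) ≤ 1729 * Y := by linarith
  set N : ℕ := Nat.ceil (1729 * Y) with hN
  have hYN : 1729 * Y ≤ N := Nat.le_ceil _
  refine (Set.Finite.prod (Set.finite_Icc (-(N : ℤ)) N) (Set.finite_Icc (-(N : ℤ)) N)).subset ?_
  rintro ⟨x, y⟩ ⟨-, -, -, -, -, hx, hxy, -, -⟩
  simp only [Set.mem_prod, Set.mem_Icc]
  have h3 : (((|x| ^ 3 : ℤ)) : ℝ) = |(x : ℝ)| ^ 3 := by push_cast; rfl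
  have h4 : |(x : ℝ)| ^ 3 ≤ Y := h3 ▸ hx
  have hx1 : |(x : ℝ)| ^ 3 ≤ 1729 * Y := by
    have h0 : 0 ≤ Y := by linarith
    linarith
  have hx' : |(x : ℝ)| ≤ N := (abs_le_of_cube_le hY' hx1).trans hYN
  have hy1 : (y : ℝ) ^ 2 ≤ 1729 * Y := by
    have e : (((|x ^ 3 - y ^ 2| : ℤ)) : ℝ) = |(x : ℝ) ^ 3 - (y : ℝ) ^ 2| := by push_cast; rfl
    have h1 : |(x : ℝ) ^ 3 - (y : ℝ) ^ 2| ≤ 1728 * Y := e ▸ hxy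
    have h2 : (x : ℝ) ^ 3 ≤ |(x : ℝ)| ^ 3 := by
      rw [← abs_pow]; exact le_abs_self _
    have h5 := (abs_le.mp h1).1
    nlinarith
  have hy' : |(y : ℝ)| ≤ N := (abs_le_of_sq_le hY' hy1).trans hYN
  have hx'' : |x| ≤ (N : ℤ) := by exact_mod_cast hx'
  have hy'' : |y| ≤ (N : ℤ) := by exact_mod_cast hy'
  exact ⟨⟨(abs_le.mp hx'').1, (abs_le.mp hx'').2⟩, ⟨(abs_le.mp hy'').1, (abs_le.mp hy'').2⟩⟩

/-- Any regime subset of the cusp set is finite. -/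
theorem sepSet_finite (P : ℝ → ℤ × ℤ → Prop) (X Y : ℝ) (hY : 1 ≤ Y) :
    {x : ℤ × ℤ | x ∈ cuspSetD X Y ∧ P Y x}.Finite :=
  (cuspSetD_finite X Y hY).subset fun _ hx => hx.1

/-- The right side of the law is nonnegative for `X, Y ≥ 1` once the constant is. -/
theorem bound_nonneg {X Y ε : ℝ} (hX : 1 ≤ X) (hY : 1 ≤ Y) :
    0 ≤ X ^ ε * (X * Y ^ (-(1 / 6 : ℝ)) + 1) := by
  have hX0 : 0 ≤ X := by linarith
  have hY0 : 0 ≤ Y := by linarith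
  exact mul_nonneg (Real.rpow_nonneg hX0 _)
    (add_nonneg (mul_nonneg hX0 (Real.rpow_nonneg hY0 _)) zero_le_one)

/-- Monotonicity of the restricted law in the predicate. -/
theorem lawOn_mono {P Q : ℝ → ℤ × ℤ → Prop} (hPQ : ∀ Y x, P Y x → Q Y x) (hQ : LawOn Q) : LawOn P := by
  intro σ hσ ε hε
  obtain ⟨C, hC⟩ := hQ σ hσ ε hε
  refine ⟨C, fun X Y hX hY hXY hYX => le_trans ?_ (hC X Y hX hY hXY hYX)⟩
  have hsub : {x : ℤ × ℤ | x ∈ cuspSetD X Y ∧ P Y x} ⊆ {x : ℤ × ℤ | x ∈ cuspSetD X Y ∧ Q Y x} :=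
    fun x hx => ⟨hx.1, hPQ Y x hx.2⟩
  exact_mod_cast Set.ncard_le_ncard hsub (sepSet_finite Q X Y hY)

/-- Union bound: the law on `P` and on `Q` gives the law on `P ∨ Q` (constants `max C₁ 0 + max C₂ 0`). -/
theorem lawOn_or {P Q : ℝ → ℤ × ℤ → Prop} (hP : LawOn P) (hQ : LawOn Q) :
    LawOn (fun Y x => P Y x ∨ Q Y x) := by
  intro σ hσ ε hε
  obtain ⟨C₁, h₁⟩ := hP σ hσ ε hε
  obtain ⟨C₂, h₂⟩ := hQ σ hσ ε hε
  refine ⟨max C₁ 0 + max C₂ 0, fun X Y hX hY hXY hYX => ?_⟩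
  have hB := bound_nonneg (ε := ε) hX hY
  set B : ℝ := X ^ ε * (X * Y ^ (-(1 / 6 : ℝ)) + 1) with hBdef
  have hsub : {x : ℤ × ℤ | x ∈ cuspSetD X Y ∧ (P Y x ∨ Q Y x)} ⊆
      {x : ℤ × ℤ | x ∈ cuspSetD X Y ∧ P Y x} ∪ {x : ℤ × ℤ | x ∈ cuspSetD X Y ∧ Q Y x} := by
    rintro x ⟨hx, hp | hq⟩
    · exact Or.inl ⟨hx, hp⟩
    · exact Or.inr ⟨hx, hq⟩
  have hfin : ({x : ℤ × ℤ | x ∈ cuspSetD X Y ∧ P Y x} ∪ {x : ℤ × ℤ | x ∈ cuspSetD X Y ∧ Q Y x}).Finite :=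
    (sepSet_finite P X Y hY).union (sepSet_finite Q X Y hY)
  have hc1 := Set.ncard_le_ncard hsub hfin
  have hc2 := Set.ncard_union_le {x : ℤ × ℤ | x ∈ cuspSetD X Y ∧ P Y x}
    {x : ℤ × ℤ | x ∈ cuspSetD X Y ∧ Q Y x}
  have hc3 : (Set.ncard {x : ℤ × ℤ | x ∈ cuspSetD X Y ∧ (P Y x ∨ Q Y x)} : ℝ) ≤
      (Set.ncard {x : ℤ × ℤ | x ∈ cuspSetD X Y ∧ P Y x} : ℝ) +
        (Set.ncard {x : ℤ × ℤ | x ∈ cuspSetD X Y ∧ Q Y x} : ℝ) := by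
    exact_mod_cast hc1.trans hc2
  have hP' : (Set.ncard {x : ℤ × ℤ | x ∈ cuspSetD X Y ∧ P Y x} : ℝ) ≤ max C₁ 0 * B := by
    calc (Set.ncard {x : ℤ × ℤ | x ∈ cuspSetD X Y ∧ P Y x} : ℝ) ≤ C₁ * B := by
          have h := h₁ X Y hX hY hXY hYX
          rw [hBdef, ← mul_assoc]; exact h
      _ ≤ max C₁ 0 * B := mul_le_mul_of_nonneg_right (le_max_left _ _) hB
  have hQ' : (Set.ncard {x : ℤ × ℤ | x ∈ cuspSetD X Y ∧ Q Y x} : ℝ) ≤ max C₂ 0 * B := by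
    calc (Set.ncard {x : ℤ × ℤ | x ∈ cuspSetD X Y ∧ Q Y x} : ℝ) ≤ C₂ * B := by
          have h := h₂ X Y hX hY hXY hYX
          rw [hBdef, ← mul_assoc]; exact h
      _ ≤ max C₂ 0 * B := mul_le_mul_of_nonneg_right (le_max_left _ _) hB
  calc (Set.ncard {x : ℤ × ℤ | x ∈ cuspSetD X Y ∧ (P Y x ∨ Q Y x)} : ℝ)
      ≤ max C₁ 0 * B + max C₂ 0 * B := hc3.trans (add_le_add hP' hQ')
    _ = (max C₁ 0 + max C₂ 0) * X ^ ε * (X * Y ^ (-(1 / 6 : ℝ)) + 1) := by rw [hBdef]; ring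

/-- The three regimes cover every pair (pure case analysis on the two real thresholds). -/
theorem regimes_cover (Y : ℝ) (x : ℤ × ℤ) :
    (ResolvedRegime Y x ∨ DeepRegime Y x) ∨ HallRegime Y x := by
  by_cases hH : HallRegime Y x
  · exact Or.inr hH
  · have hH' : ¬ (((|x.1 ^ 3 - x.2 ^ 2| : ℤ) : ℝ) ≤ 1728 * Y ^ (1 / 2 : ℝ)) := hH
    rcases le_or_gt (Y ^ (1 / 6 : ℝ)) (simpleRad x : ℝ) with h6 | h6
    · exact Or.inl (Or.inl ⟨hH', h6⟩)
    · exact Or.inl (Or.inr ⟨hH', h6⟩)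

/-- The law on all pairs (predicate `True`) is C⁺′. -/
theorem cuspLawD_of_lawOn_true (h : LawOn fun _ _ => True) : CuspLawD := by
  intro σ hσ ε hε
  obtain ⟨C, hC⟩ := h σ hσ ε hε
  refine ⟨C, fun X Y hX hY hXY hYX => ?_⟩
  have hset : {x : ℤ × ℤ | x ∈ cuspSetD X Y ∧ True} = cuspSetD X Y := by
    ext x; simp
  have h1 := hC X Y hX hY hXY hYX
  rw [hset] at h1
  exact h1

/-- **C⁺′ from the three regime laws** (union bound over the cover). -/
theorem cuspLawD_of_regimes (h3 : LawOn ResolvedRegime) (h4 : LawOn DeepRegime) (h5 : LawOn HallRegime) :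
    CuspLawD := by
  have h34 : LawOn (fun Y x => ResolvedRegime Y x ∨ DeepRegime Y x) := lawOn_or h3 h4
  have hall : LawOn (fun Y x => (ResolvedRegime Y x ∨ DeepRegime Y x) ∨ HallRegime Y x) := lawOn_or h34 h5
  exact cuspLawD_of_lawOn_true (lawOn_mono (fun Y x _ => regimes_cover Y x) hall)

/-- **The line's composition over named statements**: the transfer and the three regime laws give the
crux (pure logic over the union bound `cuspLawD_of_regimes`). With `CuspSumBound` proved, the
registered stubs `stub_resolvedRegime : ResolvedRegimeLaw` and `stub_deepRegime : DeepRegimeLaw`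
supply the first two regime laws. -/
theorem sharpModerateLaw_of_transfer_of_regimeLaws :
    TransferD → LawOn ResolvedRegime → LawOn DeepRegime → LawOn HallRegime → Summit.ABC.ABC.Theses.TwistAmplification.SharpModerateLaw :=
  fun h1 h3 h4 h5 => h1 (cuspLawD_of_regimes h3 h4 h5)

end Summit.ABC.ABC.Theorems.SharpModerateLaw.CuspDispersion

end
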